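import Mathlib
import Summits.Ventures.PercRepro2.SwGlue

/-!
# Row (SW) across a cut separating `o` from `{l, h}` (blind cell PercRepro2, night-4 g4, 2026-08-24;
NIGHT4-SIDE.md §5′ P3)

`o` on the first side, `l, h` on the second.  On `Q(G)` the cut vertex `c` is red-connected to `l`
(`o ∈ C_R(l)` needs it), hence `c ∉ C_R(h)` and `C_R(h)` lives on the `h`-side.  Two classes: `c` on
the red side of `l` (then the `h`-side configuration is in `Q(G₂; l, h, c)` — apply (SW)(G₂) there)
and `c` in the core of `l` (a swap-symmetric class — swap the `h`-side).  `sw_glue_sep_o`: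
(SW)(G₂; l, h, c) ⟹ (SW)(G; l, h, o).
-/

namespace Summit.Ventures.PercRepro2

namespace Glue

open Hull LocRows

open scoped Classical

variable {V : Type*} {E₁ E₂ : Type*} {ends₁ : E₁ → Sym2 V} {ends₂ : E₂ → Sym2 V} {c : V}
  {V₁ V₂ : Set V}

/-- A vertex of the first side other than `c` is in the cluster of `v ∈ V₂` iff the `G₂`-cluster of
`v` contains `c` and the `G₁`-cluster of `c` contains it. -/
lemma mem_cluster_glue_iff_across₂ (hg : IsGluing ends₁ ends₂ c V₁ V₂) {ζ : Config (E₁ ⊕ E₂)}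
    {v u : V} (hv : v ∈ V₂) (hu : u ∈ V₁) (huc : u ≠ c) :
    u ∈ cluster (glue ends₁ ends₂) ζ v ↔
      c ∈ cluster ends₂ (ζ ∘ Sum.inr) v ∧ u ∈ cluster ends₁ (ζ ∘ Sum.inl) c := by
  rw [cluster_glue_eq₂ hg hv]
  simp only [Set.mem_union, Set.mem_setOf_eq]
  constructor
  · rintro (h | h)
    · exact absurd (hg.inter u hu (cluster_subset_of_mem₂ hg hv h)) huc
    · exact h
  · exact Or.inr

variable [Fintype E₁] [Fintype E₂] [DecidableEq E₁] [DecidableEq E₂]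

/-- **(SW) across a cut separating `o` from `{l, h}`**: (SW) on the `{l, h}`-side with the cut vertex
as the marked vertex gives (SW) on the glued graph. -/
theorem sw_glue_sep_o {l h o : V} (hg : IsGluing ends₁ ends₂ c V₁ V₂) (ho : o ∈ V₁) (hoc : o ≠ c)
    (hl : l ∈ V₂) (hh : h ∈ V₂) (hhc : h ≠ c) (h₂ : Sw ends₂ l h c) :
    Sw (glue ends₁ ends₂) l h o := by
  obtain ⟨f₂, hf₂, hmem₂⟩ := h₂
  -- membership in `Q(G)`
  have key : ∀ ζ : Config (E₁ ⊕ E₂),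
      ζ ∈ tgtU (glue ends₁ ends₂) l h {S : Set V | o ∈ S} ↔
        (h ∉ cluster ends₂ (ζ ∘ Sum.inr) l ∧ h ∉ cluster ends₂ (blue (ζ ∘ Sum.inr)) l) ∧
          (c ∈ cluster ends₂ (ζ ∘ Sum.inr) l ∧ o ∈ cluster ends₁ (ζ ∘ Sum.inl) c) ∧
          ¬ (c ∈ cluster ends₂ (blue (ζ ∘ Sum.inr)) l ∧ o ∈ cluster ends₁ (blue (ζ ∘ Sum.inl)) c) := by
    intro ζ
    rw [mem_tgtU_glue_iff, mem_cluster_glue_iff₂ hg hl hh hhc, mem_cluster_glue_iff₂ hg hl hh hhc,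
      mem_cluster_glue_iff_across₂ hg hl ho hoc, mem_cluster_glue_iff_across₂ hg hl ho hoc,
      blue_comp_inl, blue_comp_inr]
  -- membership in `Q(G₂; l, h, c)`
  have key₂ : ∀ ζ₂ : Config E₂,
      ζ₂ ∈ tgtU ends₂ l h {S : Set V | c ∈ S} ↔
        (h ∉ cluster ends₂ ζ₂ l ∧ h ∉ cluster ends₂ (blue ζ₂) l) ∧
          c ∈ cluster ends₂ ζ₂ l ∧ c ∉ cluster ends₂ (blue ζ₂) l := by
    intro ζ₂
    simp only [tgtU, Finset.mem_filter, Finset.mem_univ, true_and, mem_hull_iff, Set.mem_setOf_eq,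
      not_or]
  -- on `Q(G)` the red cluster of `h` lives on the `h`-side
  have hT : ∀ ζ : Config (E₁ ⊕ E₂), ζ ∈ tgtU (glue ends₁ ends₂) l h {S : Set V | o ∈ S} →
      cluster (glue ends₁ ends₂) ζ h = cluster ends₂ (ζ ∘ Sum.inr) h := by
    intro ζ hζ
    obtain ⟨⟨h1, _⟩, ⟨h3, _⟩, _⟩ := (key ζ).1 hζ
    rw [cluster_glue_eq₂ hg hh]
    ext u
    simp only [Set.mem_union, Set.mem_setOf_eq]
    constructor
    · rintro (hu | ⟨hc, _⟩)
      · exact hu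
      · -- `c ∈ C₂(h)` and `c ∈ C₂(l)` would join `l` to `h`
        have hlc : Conn ends₂ (ζ ∘ Sum.inr) l c := h3
        have hch : Conn ends₂ (ζ ∘ Sum.inr) c h := conn_symm hc
        exact absurd (conn_trans hlc hch) h1
    · exact Or.inl
  -- the red class lies in `Q(G₂; l, h, c)`
  have py : ∀ y : {ζ // ζ ∈ tgtU (glue ends₁ ends₂) l h {S : Set V | o ∈ S}},
      c ∉ cluster ends₂ (blue (y.1 ∘ Sum.inr)) l →
        y.1 ∘ Sum.inr ∈ tgtU ends₂ l h {S : Set V | c ∈ S} := fun y hy =>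
    (key₂ _).2 ⟨((key _).1 y.2).1, ((key _).1 y.2).2.1.1, hy⟩
  -- the image of the red class is in the red class
  have hred : ∀ (y : {ζ // ζ ∈ tgtU (glue ends₁ ends₂) l h {S : Set V | o ∈ S}})
      (hy : c ∉ cluster ends₂ (blue (y.1 ∘ Sum.inr)) l),
        c ∉ cluster ends₂ (blue (f₂ ⟨y.1 ∘ Sum.inr, py y hy⟩)) l := fun y hy =>
    ((key₂ _).1 (hmem₂ ⟨y.1 ∘ Sum.inr, py y hy⟩).1).2.2
  refine ⟨fun x => if hK : c ∈ cluster ends₂ (blue (x.1 ∘ Sum.inr)) l then swap₂ x.1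
      else pair (x.1 ∘ Sum.inl) (f₂ ⟨x.1 ∘ Sum.inr, py x hK⟩), ?_, ?_⟩
  · -- injective: the class of the image is the class of the source
    intro x y hxy
    simp only at hxy
    by_cases hx : c ∈ cluster ends₂ (blue (x.1 ∘ Sum.inr)) l <;>
      by_cases hy : c ∈ cluster ends₂ (blue (y.1 ∘ Sum.inr)) l
    · rw [dif_pos hx, dif_pos hy] at hxy
      have := congrArg swap₂ hxy
      simp only [swap₂_swap₂] at this
      exact Subtype.ext this
    · rw [dif_pos hx, dif_neg hy] at hxy
      have h2 := congrArg (fun ζ => ζ ∘ Sum.inr) hxy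
      simp only [swap₂_inr, pair_inr] at h2
      have := hred y hy
      rw [← h2, blue_blue] at this
      exact absurd ((key x.1).1 x.2).2.1.1 this
    · rw [dif_neg hx, dif_pos hy] at hxy
      have h2 := congrArg (fun ζ => ζ ∘ Sum.inr) hxy
      simp only [swap₂_inr, pair_inr] at h2
      have := hred x hx
      rw [h2, blue_blue] at this
      exact absurd ((key y.1).1 y.2).2.1.1 this
    · rw [dif_neg hx, dif_neg hy] at hxy
      have h1 := congrArg (fun ζ => ζ ∘ Sum.inl) hxy
      have h2 := congrArg (fun ζ => ζ ∘ Sum.inr) hxy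
      simp only [pair_inl, pair_inr] at h1 h2
      have h2' : x.1 ∘ Sum.inr = y.1 ∘ Sum.inr := congrArg Subtype.val (hf₂ h2)
      apply Subtype.ext
      rw [← pair_comp x.1, ← pair_comp y.1, h1, h2']
  · intro x
    obtain ⟨⟨h1, h2⟩, ⟨h3, h4⟩, h5⟩ := (key x.1).1 x.2
    by_cases hK : c ∈ cluster ends₂ (blue (x.1 ∘ Sum.inr)) l
    · -- the core class: swap the `h`-side
      simp only [dif_pos hK]
      refine ⟨(key _).2 ?_, ?_⟩
      · rw [swap₂_inl, swap₂_inr, blue_blue]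
        exact ⟨⟨h2, h1⟩, ⟨hK, h4⟩, fun h6 => h5 ⟨hK, h6.2⟩⟩
      · rw [hT x.1 x.2, cluster_glue_eq₂ hg hh, blue_swap₂_inr]
        exact fun u hu => Or.inl hu
    · -- the red class: (SW) on the `h`-side
      simp only [dif_neg hK]
      obtain ⟨ht, hsub⟩ := hmem₂ ⟨x.1 ∘ Sum.inr, py x hK⟩
      obtain ⟨⟨h1', h2'⟩, h3', h4'⟩ := (key₂ _).1 ht
      refine ⟨(key _).2 ?_, ?_⟩
      · rw [pair_inl, pair_inr]
        exact ⟨⟨h1', h2'⟩, ⟨h3', h4⟩, fun h6 => h4' h6.1⟩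
      · rw [hT x.1 x.2, cluster_glue_eq₂ hg hh, blue_pair, pair_inr]
        exact fun u hu => Or.inl (hsub hu)

end Glue

end Summit.Ventures.PercRepro2
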